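import Summits.MatrixMultiplication.MatrixMultiplication.Theorems.ObstructionCalculusSchurWeylConverse
import Summits.MatrixMultiplication.MatrixMultiplication.Theorems.ObstructionDescentDominance

set_option linter.dupNamespace false
set_option autoImplicit false

/-!
# Obstruction descent — the crux `P_O` IS Bürgisser–Ikenmeyer semigroup containment (decomp-mm · lens 3 · gen 29, def-free)

`route-MatrixMultiplication-ObstructionDescent`, crux `NoOccurrenceObstruction` (`P_O`, stmt 29040); NODE-g29 §3.  Route-dependent
part of the Schur–Weyl bridge (`ObstructionCalculusSchurWeyl`, `…Converse`, route-free): the lens's ONE CERTIFIED TRANSLATION of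
the crux, `noOccurrenceObstruction_iff_semigroup_containment`:

  `P_O  ⟺  ∀ τ > 2, ∃ n₀, ∀ n ≥ n₀, ∀ m, n² ≤ m ∧ n^τ ≤ m →  S(⟨n,n,n⟩) ⊆ S(⟨m⟩)`,

where `S(t) = {(d; λ⁰,λ¹,λ²) : λ occurs in t^{⊗d}}` is Bürgisser–Ikenmeyer's semigroup of a tensor in the tree's ISOTYPIC model
(`isotypicSum₁ λ⁰ (isotypicSum₂ λ¹ (isotypicSum₃ λ² (kroneckerPow t d))) ≠ 0`; `IsotypicOccurrenceSemigroup`,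
`UnitTensorMomentPolytope*`, `UnitTensorSLObstructions*`).  Ingredients beyond the route-free bridge:
* §1 the route's two tensors in the isotypic model: occurrence of a reversed partition type for `pad_m⟨n,n,n⟩` (any format
  `m ≥ n²`) ⟺ membership in `S(⟨n,n,n⟩)` (padding is invisible, `isotypicSum_kroneckerPow_padTensor_ne_zero_iff`); for `⟨m⟩` ⟺
  membership in `S(⟨m⟩)`;
* §2 TYPE REALISABILITY (`exists_partition_of_hwvSpace_ne_bot`): a live type `(Λ,d)` of the calculus (`hwvSpace Λ d ≠ ⊥`) is a
  reversed triple of partitions of `d` with at most `m` parts — by the route's DOMINANCE THEOREM (`monotone_of_hwvSpace_ne_bot`)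
  and slot-sum law (`sum_eq_degree_of_hwvSpace_ne_bot`) plus the Literature's `Weight.existsUnique_eq_ofPartition`; so the
  bridge's hypothesis "`Λ` is a reversed partition type" is no restriction on live types;
* §3 the pointwise equivalence at each `(n,m)` (`hwvSpace_le_imp_iff_semigroup_containment`) and the crux-level one.
Consequence for staffing `P_O`: its content is a statement about the unit-tensor semigroups `S(⟨m⟩)` in the window
`n^τ ≤ m < R̲(⟨n,n,n⟩)` (for `m ≥ R(⟨n,n,n⟩)` the containment is the tree's `not_hwvSpace_le_orbitVanishing_unitTensor_of_
isotypicSum_ne_zero`); the first concrete member to decide is the BI type `((2n²−3,1,1,1), 2^{n²}, 2^{n²}) ⊢ 2n²` of Lemma 6.1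
(in `S(⟨n,n,n⟩)`: tree, `isotypicSum_bi2011_kroneckerPow_matMulTensor_ne_zero`; not in `S(⟨n²+1⟩)`: BI 2011 Lemma 6.1).
No proposition is defined; no `def`; sorry-free; standard axioms.  Nothing here proves `ω = 2` or closes an item.
[cite: BurgisserIkenmeyer2011, §3.1, Thm. 1.4, §5, Lemma 6.1] [cite: FultonHarrisGTM129, §15.5]
-/

noncomputable section

open scoped BigOperators

namespace Summit.MatrixMultiplication.MatrixMultiplication.Theorems.ObstructionCalculus

open Literature.Computability.AlgebraicComplexity (kroneckerPow isotypicSum₁ isotypicSum₂ isotypicSum₃ matMulTensor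
  unitTensor tensorRank)
open Literature.NumberTheory.DiophantineGeometry (Weight)
open Summit.MatrixMultiplication.MatrixMultiplication.Theses.ObstructionDescent (NoOccurrenceObstruction)
open Summit.MatrixMultiplication.MatrixMultiplication.Theorems.ObstructionDescentInformationAxis
  (noOccurrenceObstruction_iff)
open Summit.MatrixMultiplication.MatrixMultiplication.Theorems.ObstructionDescentDominance (monotone_of_hwvSpace_ne_bot)
open Summit.MatrixMultiplication.MatrixMultiplication.Theorems.ObstructionDescentIrreducibleTypes
  (sum_eq_degree_of_hwvSpace_ne_bot)

variable {m : ℕ}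

/-! ### §1 The route's tensors in the isotypic model -/

/-- **`S(⟨n,n,n⟩)` in the calculus, exactly.**  In every format `m ≥ n²`, a reversed partition type occurs for the padded
matrix multiplication tensor `pad_m⟨n,n,n⟩` iff the triple occurs in `⟨n,n,n⟩^{⊗d}`.
[cite: BurgisserIkenmeyer2011, §3.1, Thm. 1.4] -/
theorem not_hwvSpace_le_orbitVanishing_padMM_iff (n m : ℕ) (h : n * n ≤ m) {d : ℕ} (lam : Fin 3 → Nat.Partition d)
    (Λ : Fin 3 → Fin m → ℕ) (hΛ : ∀ (s : Fin 3) (i : Fin m), Λ s (Fin.rev i) = (lam s).sortedParts.getD i 0) :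
    ¬ hwvSpace Λ d ≤ orbitVanishing (padMM ℂ n m h) ↔
      isotypicSum₁ (lam 0) (isotypicSum₂ (lam 1) (isotypicSum₃ (lam 2)
        (kroneckerPow (matMulTensor ℂ n n n) d))) ≠ 0 := by
  classical
  rw [not_hwvSpace_le_orbitVanishing_iff_isotypicSum_ne_zero _ lam Λ hΛ, padMM,
    isotypicSum_kroneckerPow_padTensor_ne_zero_iff (padIdx_injective' n m h)]

/-- **`S(⟨m⟩)` in the calculus, exactly.**  A reversed partition type occurs for the unit tensor `σ_m = ⟨m⟩` iff the triple
occurs in `⟨m⟩^{⊗d}`, i.e. lies in Bürgisser–Ikenmeyer's unit-tensor semigroup. [cite: BurgisserIkenmeyer2011, §3.1, §5] -/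
theorem not_hwvSpace_le_orbitVanishing_unitTensor_iff (m : ℕ) {d : ℕ} (lam : Fin 3 → Nat.Partition d)
    (Λ : Fin 3 → Fin m → ℕ) (hΛ : ∀ (s : Fin 3) (i : Fin m), Λ s (Fin.rev i) = (lam s).sortedParts.getD i 0) :
    ¬ hwvSpace Λ d ≤ orbitVanishing (unitTensor ℂ m) ↔
      isotypicSum₁ (lam 0) (isotypicSum₂ (lam 1) (isotypicSum₃ (lam 2) (kroneckerPow (unitTensor ℂ m) d))) ≠ 0 :=
  not_hwvSpace_le_orbitVanishing_iff_isotypicSum_ne_zero _ lam Λ hΛ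

/-! ### §2 Type realisability: live types are reversed partition triples -/

/-- **Live types are reversed triples of partitions.**  If `hwvSpace Λ d ≠ ⊥` then there are partitions `λ⁰, λ¹, λ² ⊢ d`
with at most `m` parts such that `Λ s (rev i) = λˢ_i`: each `Λ s` is monotone (dominance theorem) with `Σ_i Λ s i = d`
(slot-sum law), so `i ↦ Λ s (rev i)` is a polynomial weight of size `d`, i.e. a padded partition.
[cite: BurgisserIkenmeyer2011, §3.1] [cite: FultonHarrisGTM129, §15.5] -/
theorem exists_partition_of_hwvSpace_ne_bot {Λ : Fin 3 → Fin m → ℕ} {d : ℕ} (h : hwvSpace Λ d ≠ ⊥) :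
    ∃ lam : Fin 3 → Nat.Partition d, (∀ s, (lam s).parts.card ≤ m) ∧
      ∀ (s : Fin 3) (i : Fin m), Λ s (Fin.rev i) = (lam s).sortedParts.getD i 0 := by
  classical
  have hex : ∀ s : Fin 3, ∃ mu : Nat.Partition d, mu.parts.card ≤ m ∧
      ∀ i : Fin m, Λ s (Fin.rev i) = mu.sortedParts.getD i 0 := by
    intro s
    set χ : Weight (Fin m) := fun i => ((Λ s (Fin.rev i) : ℕ) : ℤ) with hχdef
    have hχ : χ.IsPolynomial := by
      refine ⟨fun i j hij => ?_, fun i => ?_⟩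
      · simp only [hχdef]
        exact_mod_cast monotone_of_hwvSpace_ne_bot h s (Fin.rev_le_rev.2 hij)
      · simp only [hχdef]
        exact Int.natCast_nonneg _
    have hsize : χ.size.toNat = d := by
      simp only [Weight.size, hχdef]
      rw [← Nat.cast_sum, Int.toNat_natCast, ← sum_eq_degree_of_hwvSpace_ne_bot h s]
      exact Fintype.sum_bijective Fin.rev Fin.rev_involutive.bijective _ _ fun i => rfl
    obtain ⟨mu, ⟨hmuN, hmuχ⟩, -⟩ := Weight.existsUnique_eq_ofPartition_holds hχ
    refine ⟨⟨mu.parts, fun hi => mu.parts_pos hi, by rw [mu.parts_sum, hsize]⟩, hmuN, fun i => ?_⟩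
    have hi := congrFun hmuχ i
    rw [Weight.ofPartition_apply] at hi
    simp only [hχdef] at hi
    show Λ s (Fin.rev i) = mu.sortedParts.getD (i : ℕ) 0
    exact_mod_cast hi.symm
  choose lam hcard hlam using hex
  exact ⟨lam, hcard, hlam⟩

/-! ### §3 The crux is semigroup containment -/

/-- **Pointwise translation at `(n,m)`.**  In a format `m ≥ n²`: every type of the calculus vanishing on the orbit of `⟨m⟩`
vanishes on the orbit of `pad_m⟨n,n,n⟩` (the matrix of `P_O` at `(n,m)`) **iff** `S(⟨n,n,n⟩) ⊆ S(⟨m⟩)` (every triple of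
partitions occurring in `⟨n,n,n⟩^{⊗d}` occurs in `⟨m⟩^{⊗d}`).  ⟹: the route-free `matMul_occurs`-argument
(`isotypicSum_ne_zero_imp_of_hwvSpace_le_imp`); ⟸: realisability §2 + the two translations §1.
[cite: BurgisserIkenmeyer2011, §3.1, Thm. 1.4, §5] -/
theorem hwvSpace_le_imp_iff_semigroup_containment (n m : ℕ) (h : n * n ≤ m) :
    (∀ (Λ : Fin 3 → Fin m → ℕ) (d : ℕ), hwvSpace Λ d ≤ orbitVanishing (unitTensor ℂ m) →
        hwvSpace Λ d ≤ orbitVanishing (padMM ℂ n m h)) ↔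
      ∀ (d : ℕ) (lam : Fin 3 → Nat.Partition d),
        isotypicSum₁ (lam 0) (isotypicSum₂ (lam 1) (isotypicSum₃ (lam 2)
          (kroneckerPow (matMulTensor ℂ n n n) d))) ≠ 0 →
        isotypicSum₁ (lam 0) (isotypicSum₂ (lam 1) (isotypicSum₃ (lam 2) (kroneckerPow (unitTensor ℂ m) d))) ≠ 0 := by
  classical
  refine ⟨fun hP d lam hocc => ?_, fun hS Λ d hle => ?_⟩
  · refine isotypicSum_ne_zero_imp_of_hwvSpace_le_imp (unitTensor ℂ m) (padMM ℂ n m h) (fun d Λ => hP Λ d) d lam ?_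
    rw [padMM, isotypicSum_kroneckerPow_padTensor_ne_zero_iff (padIdx_injective' n m h)]
    exact hocc
  · by_contra hnot
    have hne : hwvSpace Λ d ≠ ⊥ := by
      rintro hbot
      exact hnot (hbot ▸ bot_le)
    obtain ⟨lam, -, hΛ⟩ := exists_partition_of_hwvSpace_ne_bot hne
    have hocc := (not_hwvSpace_le_orbitVanishing_padMM_iff n m h lam Λ hΛ).1 hnot
    exact (not_hwvSpace_le_orbitVanishing_unitTensor_iff m lam Λ hΛ).2 (hS d lam hocc) hle

/-- **THE CRUX `P_O` IS BÜRGISSER–IKENMEYER SEMIGROUP CONTAINMENT** (the lens's certified translation):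
`NoOccurrenceObstruction ⟺ ∀ τ > 2, ∃ n₀, ∀ n ≥ n₀, ∀ m ≥ n² with n^τ ≤ m, S(⟨n,n,n⟩) ⊆ S(⟨m⟩)` — every triple of partitions
occurring in a tensor power of `⟨n,n,n⟩` occurs in the same power of the unit tensor `⟨m⟩`, in every format `m ≥ n^τ`,
eventually in `n`.  (True for `m ≥ R(⟨n,n,n⟩)`; BI 2011 Thm. 1.4 / Lemma 6.1 exhibit, at the single format `m = n²+1`, an element
of `S(⟨n,n,n⟩) ∖ S(⟨m⟩)`; the crux asserts that no such element survives at formats `m ≥ n^τ`, `τ > 2`.)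
[cite: BurgisserIkenmeyer2011, §3.1, Thm. 1.4, §5, Lemma 6.1] -/
theorem noOccurrenceObstruction_iff_semigroup_containment :
    NoOccurrenceObstruction ↔
      ∀ τ : ℝ, 2 < τ → ∃ n₀ : ℕ, ∀ n m : ℕ, n₀ ≤ n → n * n ≤ m → (n : ℝ) ^ τ ≤ (m : ℝ) →
        ∀ (d : ℕ) (lam : Fin 3 → Nat.Partition d),
          isotypicSum₁ (lam 0) (isotypicSum₂ (lam 1) (isotypicSum₃ (lam 2)
            (kroneckerPow (matMulTensor ℂ n n n) d))) ≠ 0 →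
          isotypicSum₁ (lam 0) (isotypicSum₂ (lam 1) (isotypicSum₃ (lam 2) (kroneckerPow (unitTensor ℂ m) d))) ≠ 0 := by
  rw [noOccurrenceObstruction_iff]
  refine ⟨fun hP τ hτ => ?_, fun hS τ hτ => ?_⟩
  · obtain ⟨n₀, hn₀⟩ := hP τ hτ
    exact ⟨n₀, fun n m hn hnm hτm =>
      (hwvSpace_le_imp_iff_semigroup_containment n m hnm).1 (hn₀ n m hn hnm hτm)⟩
  · obtain ⟨n₀, hn₀⟩ := hS τ hτ
    exact ⟨n₀, fun n m hn hnm hτm =>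
      (hwvSpace_le_imp_iff_semigroup_containment n m hnm).2 (hn₀ n m hn hnm hτm)⟩

/-- **What `P_O` obliges, member by member** (positive form): under `P_O`, for every `τ > 2`, eventually in `n`, every element
of `S(⟨n,n,n⟩)` lies in `S(⟨m⟩)` for every format `m ≥ n^τ`; in particular the BI type of Lemma 6.1 (an element of
`S(⟨n,n,n⟩)` by the tree's `isotypicSum_bi2011_kroneckerPow_matMulTensor_ne_zero`) must occur in `⟨m⟩^{⊗2n²}` for all such `m`.
[cite: BurgisserIkenmeyer2011, Lemma 6.1] -/
theorem semigroup_containment_of_noOccurrenceObstruction (hP : NoOccurrenceObstruction) {τ : ℝ} (hτ : 2 < τ) :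
    ∃ n₀ : ℕ, ∀ n m : ℕ, n₀ ≤ n → n * n ≤ m → (n : ℝ) ^ τ ≤ (m : ℝ) →
      ∀ (d : ℕ) (lam : Fin 3 → Nat.Partition d),
        isotypicSum₁ (lam 0) (isotypicSum₂ (lam 1) (isotypicSum₃ (lam 2)
          (kroneckerPow (matMulTensor ℂ n n n) d))) ≠ 0 →
        isotypicSum₁ (lam 0) (isotypicSum₂ (lam 1) (isotypicSum₃ (lam 2) (kroneckerPow (unitTensor ℂ m) d))) ≠ 0 :=
  (noOccurrenceObstruction_iff_semigroup_containment.1 hP) τ hτ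

/-- **The containment holds above the rank**: for `m ≥ R(⟨n,n,n⟩)` (and `m ≥ n²`), `S(⟨n,n,n⟩) ⊆ S(⟨m⟩)` — so the content of
`P_O` sits in the window `n^τ ≤ m < R(⟨n,n,n⟩)`. [cite: BurgisserIkenmeyer2011, §3.1 (S(t) ⊆ S(⟨r⟩) for R(t) ≤ r)] -/
theorem semigroup_containment_of_tensorRank_le (n m : ℕ) (h : n * n ≤ m) (hr : tensorRank (matMulTensor ℂ n n n) ≤ m)
    {d : ℕ} (lam : Fin 3 → Nat.Partition d)
    (hocc : isotypicSum₁ (lam 0) (isotypicSum₂ (lam 1) (isotypicSum₃ (lam 2)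
      (kroneckerPow (matMulTensor ℂ n n n) d))) ≠ 0) :
    isotypicSum₁ (lam 0) (isotypicSum₂ (lam 1) (isotypicSum₃ (lam 2) (kroneckerPow (unitTensor ℂ m) d))) ≠ 0 := by
  set Λ : Fin 3 → Fin m → ℕ := fun s j => (lam s).sortedParts.getD (Fin.rev j) 0 with hΛdef
  have hΛ : ∀ (s : Fin 3) (i : Fin m), Λ s (Fin.rev i) = (lam s).sortedParts.getD i 0 := by
    intro s i
    simp only [hΛdef, Fin.rev_rev]
  exact (not_hwvSpace_le_orbitVanishing_unitTensor_iff m lam Λ hΛ).1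
    (not_hwvSpace_le_orbitVanishing_unitTensor_of_isotypicSum_ne_zero n m h hr lam Λ hΛ hocc)

end Summit.MatrixMultiplication.MatrixMultiplication.Theorems.ObstructionCalculus

end
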